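import Mathlib.LinearAlgebra.Matrix.AbsoluteValue
import Literature.Geometry.Lorentzian.AsymptoticFlatnessChart
import Literature.Geometry.Lorentzian.AsymptoticallyFlatChart
import Literature.Geometry.Lorentzian.ScalarCurvatureLinearization
import Literature.Geometry.Lorentzian.RicciNormSq
import HarnessLib

/-!
# Decay of the Ricci tensor on an asymptotically flat end

Support file (all results proved, no named facts) for step 2 of Schoen–Yau's positive mass
rigidity (Comm. Math. Phys. 65 (1979), §3, (3.24)–(3.30); `RicciVariationSteps.lean`): the
finiteness of `∫_N ‖Ric‖² dx` in (3.30) rests on the decay of the Ricci tensor along the end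
(p. 73: the family `ds² + t Ric` is asymptotically flat "by (1.2)", i.e. `Ric` and its derivatives
decay). Here the size of `‖Ric‖²_h` on the end is bounded explicitly in terms of the chart
components `h_{ij} = hCoeff e D` and their first two derivatives:

* `OpensChart.ricci_eq_coord` — **the Ricci tensor in coordinates** for a smooth metric on
  `U : Opens E` (the summand of `OpensChart.scalarCurvature_eq_coord`, `ChartScalarCurvature.lean`):
  `Ric(β_k, β_l) = ∑ g^{ji} [½(∂K − ∂K) − g^{ca} ¼KK + g^{ca} ¼KK]`, `K` the Koszul form;
* `PseudoRiemannianMetric.normSq_ricci_comap` — **naturality of `‖Ric‖²`** under local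
  diffeomorphisms, `|Ric^{Φ^*g}|²(u) = |Ric^g|²(Φ u)` (as `scalarCurvature_comap`,
  `CurvatureNaturality.lean`, through the frame formula `normSq_eq_sum_gram_inv`);
* `abs_ricciSum_le`, `abs_normSqSum_le` — the elementary bounds for these coordinate expressions
  when `|g^{ij}| ≤ 2`;
* `AFEnd.normSq_ricci_dataChart_le` — **the pointwise bound on the end**:
  `‖Ric‖²_h(Φ z) ≤ 3⁴ · 4ρ²`, `ρ = 18 (3‖D²h(z)‖ + 9 (3‖Dh(z)‖)²)`, as soon as `‖h(z) − δ‖ ≤ 1/6`;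
* `AFEnd.exists_bound_normSq_ricci` — **decay**: under `h − δ = O₂(r^{−α})`, `α > 0`
  (`IsMetricAsymptoticallyFlat`), `‖Ric‖²_h(Φ z) ≤ K ‖z‖^{−(2α+4)}` for `‖z‖ ≥ R₁`;
* `AFEnd.exists_radius_sqrt_det_hCoeff_le` — the volume density `√(det h_{ij})` is `≤ 7` far out;
* `AFEnd.IsStronglyAsymptoticallyFlatWith.isMetricAsymptoticallyFlat_of_massZero` —
  `h − δ = o_{nh}(r^{−β})` with `nh ≥ 2` (mass parameter `0`) implies `h − δ = O₂(r^{−β})`.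

## References

* R. Schoen, S.-T. Yau, *On the proof of the positive mass conjecture in general relativity*,
  Comm. Math. Phys. 65 (1979) 45–76, §3, p. 73, (3.30).
* B. O'Neill, *Semi-Riemannian geometry* (1983), Ch. 3, Lemma 3.38, Lemma 3.52, Prop. 3.59.
* R. Bartnik, *The mass of an asymptotically flat manifold*, CPAM 39 (1986), §4, (4.3)–(4.4)
  (the analogous estimate for the scalar curvature).
-/

noncomputable section

-- instance search on the nested operator spaces of metric components and their derivatives
-- (`E3 →L[ℝ] E3 →L[ℝ] E3 →L[ℝ] E3 →L[ℝ] ℝ` for second derivatives) is deep and slow on `E3`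
set_option maxSynthPendingDepth 3
set_option synthInstance.maxHeartbeats 200000

open Bundle Set Function Filter TopologicalSpace Manifold Metric Bornology Finset
open scoped Manifold ContDiff Topology

namespace Literature.Geometry.Lorentzian

/-! ### The Ricci tensor of a metric on `U : Opens E` in coordinates -/

namespace OpensChart

variable {E : Type*} [NormedAddCommGroup E] [NormedSpace ℝ E] [FiniteDimensional ℝ E]
  [CompleteSpace E] {U : Opens E}
  {g : PseudoRiemannianMetric 𝓘(ℝ, E) ∞ E (TangentSpace 𝓘(ℝ, E) : U → Type _)}
  {G : E → E →L[ℝ] E →L[ℝ] ℝ} (hG : ∀ y : U, g.val y = G y)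
  {ι : Type*} [Fintype ι] [DecidableEq ι]

include hG

/-- **The Ricci tensor in coordinates** (O'Neill 1983, Ch. 3, Lemma 3.38 with Lemma 3.52). For a
smooth metric on `U : Opens E` with representative `G`, a basis `β` of `E`, Gram matrix
`𝒢ᵢⱼ(x) = G x βᵢ βⱼ` and Koszul form `K(Z,Y,W)(y) = koszulForm G y Z Y W`:
`Ric_x(β_k, β_l) = ∑_{ij} (𝒢⁻¹)_{ji} [½(∂_{βᵢ} K(β_l,β_k,βⱼ) − ∂_{β_k} K(β_l,βᵢ,βⱼ))(x)
   − ∑_{ac} (𝒢⁻¹)_{ca} ½K(βⱼ,βᵢ,β_c) ½K(β_l,β_k,βₐ) + ∑_{ac} (𝒢⁻¹)_{ca} ½K(βⱼ,β_k,β_c) ½K(β_l,βᵢ,βₐ)]`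
(`Ric_{kl} = g^{ij} g(R(βᵢ,β_k)β_l, βⱼ)`, `val_riemann_eq`, `val_christoffel_christoffel_eq_sum`;
the summand of `scalarCurvature_eq_coord`). [cite: ONeill1983, Ch. 3, Lemma 3.38 and Lemma 3.52] -/
theorem ricci_eq_coord [g.HasLeviCivita] (x : U) (β : Module.Basis ι ℝ (TangentSpace 𝓘(ℝ, E) x))
    (k l : ι) :
    g.ricci x (β k) (β l) =
      ∑ i, ∑ j, (Matrix.of fun i j ↦ G x (β i) (β j))⁻¹ j i *
        (2⁻¹ * (fderiv ℝ (fun y ↦ koszulForm G y (β l) (β k) (β j)) x (β i)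
            - fderiv ℝ (fun y ↦ koszulForm G y (β l) (β i) (β j)) x (β k))
          - ∑ a, ∑ c, (Matrix.of fun i j ↦ G x (β i) (β j))⁻¹ c a *
              (2⁻¹ * koszulForm G x (β j) (β i) (β c)) * (2⁻¹ * koszulForm G x (β l) (β k) (β a))
          + ∑ a, ∑ c, (Matrix.of fun i j ↦ G x (β i) (β j))⁻¹ c a *
              (2⁻¹ * koszulForm G x (β j) (β k) (β c)) * (2⁻¹ * koszulForm G x (β l) (β i) (β a))) := by
  have hval : ∀ v w : E, g.val x v w = G x v w := fun v w ↦ by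
    rw [hG]
    rfl
  have hgram : (Matrix.of fun i j ↦ g.val x (β i) (β j)) = Matrix.of fun i j ↦ G x (β i) (β j) := by
    ext i j
    exact hval (β i) (β j)
  rw [PseudoRiemannianMetric.ricci_eq_sum g x β, hgram]
  refine Finset.sum_congr rfl fun i _ ↦ Finset.sum_congr rfl fun j _ ↦ ?_
  congr 1
  rw [val_riemann_eq hG x (β i) (β k) (β l) (β j), val_christoffel_christoffel_eq_sum hG x β,
    val_christoffel_christoffel_eq_sum hG x β]

end OpensChart

/-! ### Naturality of `‖Ric‖²` under local diffeomorphisms -/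

namespace PseudoRiemannianMetric

variable {E : Type*} [NormedAddCommGroup E] [NormedSpace ℝ E] {H : Type*} [TopologicalSpace H]
  {I : ModelWithCorners ℝ E H} {M : Type*} [TopologicalSpace M] [ChartedSpace H M]
  [IsManifold I ∞ M]
  {E' : Type*} [NormedAddCommGroup E'] [NormedSpace ℝ E'] {H' : Type*} [TopologicalSpace H']
  {I' : ModelWithCorners ℝ E' H'} {N : Type*} [TopologicalSpace N] [ChartedSpace H' N]
  [IsManifold I' ∞ N]
  [FiniteDimensional ℝ E] [FiniteDimensional ℝ E'] [CompleteSpace E] [CompleteSpace E']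
  (g : PseudoRiemannianMetric I ∞ E (TangentSpace I : M → Type _))
  {Φ : N → M} (hpb : contMDiff_pullbackBilin I M I' N ∞) (hΦ : ContMDiff I' I (∞ + 1) Φ)
  (hΦ' : ∀ u, Function.Injective (mfderiv I' I Φ u))
  (hdim : Module.finrank ℝ E' = Module.finrank ℝ E)

include hΦ' in
/-- **Naturality of `‖Ric‖²` under local diffeomorphisms**: `|Ric^{Φ^*g}|²(u) = |Ric^g|²(Φ u)`
(O'Neill 1983, Ch. 3, Prop. 3.59: local isometries preserve curvature and metric contractions).
Both square norms are expanded in bases (`normSq_eq_sum_gram_inv`): a basis `β` of `T_u N` and its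
image `dΦ_u β` of `T_{Φ u} M` have the same Gram matrices and the same Ricci components
(`ricci_comap_apply`). [cite: ONeill1983, Ch. 3, Prop. 3.59] -/
theorem normSq_ricci_comap [g.HasLeviCivita] [(g.comap hpb Φ hΦ hΦ' hdim).HasLeviCivita]
    (u : N) : (g.comap hpb Φ hΦ hΦ' hdim).normSq u ((g.comap hpb Φ hΦ hΦ' hdim).ricci u) =
      g.normSq (Φ u) (g.ricci (Φ u)) := by
  haveI : FiniteDimensional ℝ (TangentSpace I' u) := inferInstanceAs (FiniteDimensional ℝ E')
  set e := mfderivEquivOfInjective (I := I) (I' := I') Φ u (hΦ' u) hdim with he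
  set β := Module.finBasis ℝ (TangentSpace I' u) with hβ
  set β' : Module.Basis (Fin (Module.finrank ℝ (TangentSpace I' u))) ℝ (TangentSpace I (Φ u)) :=
    β.map e with hβ'
  rw [normSq_eq_sum_gram_inv (g.comap hpb Φ hΦ hΦ' hdim) u β,
    normSq_eq_sum_gram_inv g (Φ u) β']
  have hgram : (Matrix.of fun i j ↦ (g.comap hpb Φ hΦ hΦ' hdim).val u (β i) (β j)) =
      Matrix.of fun i j ↦ g.val (Φ u) (β' i) (β' j) := by
    ext i j
    simp only [Matrix.of_apply, hβ', Module.Basis.map_apply, val_comap, pullbackBilin_apply]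
    rfl
  have hric : ∀ i j, (g.comap hpb Φ hΦ hΦ' hdim).ricci u (β i) (β j) =
      g.ricci (Φ u) (β' i) (β' j) := fun i j ↦ by
    rw [g.ricci_comap_apply hpb hΦ hΦ' hdim u (β i) (β j), hβ', Module.Basis.map_apply,
      Module.Basis.map_apply]
    rfl
  rw [hgram]
  simp only [hric]

end PseudoRiemannianMetric

/-! ### Algebra: bounds for the coordinate expressions -/

section Algebra

variable {ι : Type*} [Fintype ι] [DecidableEq ι]

omit [DecidableEq ι] in
/-- `|x y z| ≤ A B C` if `|x| ≤ A`, `|y| ≤ B`, `|z| ≤ C`. [folklore] -/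
private theorem abs_mul_three_le {x y z A B C : ℝ} (hx : |x| ≤ A) (hy : |y| ≤ B) (hz : |z| ≤ C) :
    |x * y * z| ≤ A * B * C := by
  rw [abs_mul, abs_mul]
  have hA : 0 ≤ A := (abs_nonneg x).trans hx
  have hB : 0 ≤ B := (abs_nonneg y).trans hy
  exact mul_le_mul (mul_le_mul hx hy (abs_nonneg _) hA) hz (abs_nonneg _) (mul_nonneg hA hB)

omit [DecidableEq ι] in
/-- **Bound for the Ricci components in coordinates.** If `|Giᵢⱼ| ≤ 2` and the arrays `P`, `K`
are bounded by `p`, `q`, the coordinate expression of a Ricci component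
(`OpensChart.ricci_eq_coord` with `Gi = 𝒢⁻¹`, `P a b c d = ∂_{βₐ} K(β_b, β_c, β_d)`,
`K a b c = K(βₐ, β_b, β_c)`) is at most `m² · 2 (p + m² q²)` in absolute value (`m = card ι`).
[folklore] -/
theorem abs_ricciSum_le (Gi : Matrix ι ι ℝ) (P : ι → ι → ι → ι → ℝ) (K : ι → ι → ι → ℝ)
    {p q : ℝ} (hGi : ∀ i j, |Gi i j| ≤ 2) (hP : ∀ a b c d, |P a b c d| ≤ p)
    (hK : ∀ a b c, |K a b c| ≤ q) (k l : ι) :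
    |∑ i, ∑ j, Gi j i *
        (2⁻¹ * (P i l k j - P k l i j)
          - ∑ a, ∑ c, Gi c a * (2⁻¹ * K j i c) * (2⁻¹ * K l k a)
          + ∑ a, ∑ c, Gi c a * (2⁻¹ * K j k c) * (2⁻¹ * K l i a))| ≤
      (Fintype.card ι : ℝ) ^ 2 * (2 * (p + (Fintype.card ι : ℝ) ^ 2 * q ^ 2)) := by
  set m : ℝ := (Fintype.card ι : ℝ) with hm
  have hK2 : ∀ a b c, |2⁻¹ * K a b c| ≤ q / 2 := fun a b c ↦ by
    rw [abs_mul, abs_of_pos (by norm_num : (0 : ℝ) < 2⁻¹)]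
    have := hK a b c
    linarith
  have hKK : ∀ (F₁ F₂ : ι → ι → ℝ), (∀ a c, |F₁ a c| ≤ q / 2) → (∀ a c, |F₂ a c| ≤ q / 2) →
      |∑ a, ∑ c, Gi c a * F₁ a c * F₂ a c| ≤ m * (m * (2 * (q / 2) * (q / 2))) := by
    intro F₁ F₂ h₁ h₂
    refine abs_sum_le_card_mul _ fun a ↦ abs_sum_le_card_mul _ fun c ↦ ?_
    exact abs_mul_three_le (hGi c a) (h₁ a c) (h₂ a c)
  have hT : ∀ i j, |2⁻¹ * (P i l k j - P k l i j)
      - ∑ a, ∑ c, Gi c a * (2⁻¹ * K j i c) * (2⁻¹ * K l k a)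
      + ∑ a, ∑ c, Gi c a * (2⁻¹ * K j k c) * (2⁻¹ * K l i a)| ≤ p + m ^ 2 * q ^ 2 := by
    intro i j
    have h1 : |2⁻¹ * (P i l k j - P k l i j)| ≤ p := by
      rw [abs_mul, abs_of_pos (by norm_num : (0 : ℝ) < 2⁻¹)]
      have := abs_sub (P i l k j) (P k l i j)
      have := hP i l k j
      have := hP k l i j
      linarith
    have h2 := hKK (fun a c ↦ 2⁻¹ * K j i c) (fun a c ↦ 2⁻¹ * K l k a)
      (fun a c ↦ hK2 j i c) (fun a c ↦ hK2 l k a)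
    have h3 := hKK (fun a c ↦ 2⁻¹ * K j k c) (fun a c ↦ 2⁻¹ * K l i a)
      (fun a c ↦ hK2 j k c) (fun a c ↦ hK2 l i a)
    set A := 2⁻¹ * (P i l k j - P k l i j)
    set B := ∑ a, ∑ c, Gi c a * (2⁻¹ * K j i c) * (2⁻¹ * K l k a)
    set C := ∑ a, ∑ c, Gi c a * (2⁻¹ * K j k c) * (2⁻¹ * K l i a)
    calc |A - B + C| ≤ |A - B| + |C| := abs_add_le _ _
      _ ≤ |A| + |B| + |C| := by linarith [abs_sub A B]
      _ ≤ p + m * (m * (2 * (q / 2) * (q / 2))) + m * (m * (2 * (q / 2) * (q / 2))) := by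
          linarith
      _ = p + m ^ 2 * q ^ 2 := by ring
  have hX : 0 ≤ p + m ^ 2 * q ^ 2 := by
    obtain ⟨i⟩ : Nonempty ι := ⟨k⟩
    exact (abs_nonneg _).trans (hT i i)
  calc |∑ i, ∑ j, Gi j i * (2⁻¹ * (P i l k j - P k l i j)
          - ∑ a, ∑ c, Gi c a * (2⁻¹ * K j i c) * (2⁻¹ * K l k a)
          + ∑ a, ∑ c, Gi c a * (2⁻¹ * K j k c) * (2⁻¹ * K l i a))|
      ≤ m * (m * (2 * (p + m ^ 2 * q ^ 2))) := by
        refine abs_sum_le_card_mul _ fun i ↦ abs_sum_le_card_mul _ fun j ↦ ?_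
        rw [abs_mul]
        exact mul_le_mul (hGi j i) (hT i j) (abs_nonneg _) (by norm_num)
    _ = m ^ 2 * (2 * (p + m ^ 2 * q ^ 2)) := by ring

omit [DecidableEq ι] in
/-- **Bound for `‖T‖²` in coordinates.** If `|Giᵢⱼ| ≤ 2` and `|Rcᵢⱼ| ≤ ρ`, the frame expression
of the square norm (`PseudoRiemannianMetric.normSq_eq_sum_gram_inv` with `Gi = 𝒢⁻¹`,
`Rc i j = T(βᵢ, βⱼ)`) is at most `m⁴ · 4ρ²` in absolute value (`m = card ι`). [folklore] -/
theorem abs_normSqSum_le (Gi : Matrix ι ι ℝ) (Rc : ι → ι → ℝ) {ρ : ℝ}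
    (hGi : ∀ i j, |Gi i j| ≤ 2) (hRc : ∀ i j, |Rc i j| ≤ ρ) :
    |∑ i, ∑ j, Gi j i * ∑ a, (∑ c, Gi c a * Rc c i) * Rc a j| ≤
      (Fintype.card ι : ℝ) ^ 4 * (4 * ρ ^ 2) := by
  set m : ℝ := (Fintype.card ι : ℝ) with hm
  have hm0 : 0 ≤ m := Nat.cast_nonneg _
  have hρ : ∀ i : ι, 0 ≤ ρ := fun i ↦ (abs_nonneg _).trans (hRc i i)
  have h1 : ∀ a i, |∑ c, Gi c a * Rc c i| ≤ m * (2 * ρ) := fun a i ↦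
    abs_sum_le_card_mul _ fun c ↦ by
      rw [abs_mul]
      exact mul_le_mul (hGi c a) (hRc c i) (abs_nonneg _) (by norm_num)
  have h2 : ∀ i j, |∑ a, (∑ c, Gi c a * Rc c i) * Rc a j| ≤ m * (m * (2 * ρ) * ρ) := fun i j ↦
    abs_sum_le_card_mul _ fun a ↦ by
      rw [abs_mul]
      exact mul_le_mul (h1 a i) (hRc a j) (abs_nonneg _)
        (mul_nonneg hm0 (mul_nonneg (by norm_num) (hρ i)))
  calc |∑ i, ∑ j, Gi j i * ∑ a, (∑ c, Gi c a * Rc c i) * Rc a j|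
      ≤ m * (m * (2 * (m * (m * (2 * ρ) * ρ)))) := by
        refine abs_sum_le_card_mul _ fun i ↦ abs_sum_le_card_mul _ fun j ↦ ?_
        rw [abs_mul]
        exact mul_le_mul (hGi j i) (h2 i j) (abs_nonneg _) (by norm_num)
    _ = m ^ 4 * (4 * ρ ^ 2) := by ring

end Algebra

/-! ### The pointwise bound on an asymptotically flat end -/

namespace AFEnd

variable {X : Type} [TopologicalSpace X] [ChartedSpace E3 X] [IsManifold (𝓡 3) ∞ X]
  (e : AFEnd X) (D : InitialDataSet (𝓡 3) X)

/-- **`‖Ric‖²` on the end is quadratic in `(|∂²h|, |∂h|²)`.** At a point `Φ z` of the end where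
the chart components satisfy `‖h(z) − δ‖ ≤ 1/6`,
`‖Ric‖²_h(Φ z) ≤ 3⁴ · 4 ρ²` with `ρ = 3² · 2 (3‖D²h(z)‖ + 3² (3‖Dh(z)‖)²)`: by naturality
(`normSq_ricci_comap`) it is the square norm of the Ricci tensor of the pulled-back metric on
`{R < ‖x‖}`, whose frame expression (`normSq_eq_sum_gram_inv`, `OpensChart.ricci_eq_coord` in
the standard frame) is bounded by `abs_normSqSum_le`, `abs_ricciSum_le`: the inverse Gram matrix
has entries `≤ 2` (`Matrix.abs_inv_sub_one_le`), the Koszul forms are `≤ 3‖Dh‖` and their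
derivatives `≤ 3‖D²h‖`. (Schoen–Yau 1979, p. 73: `Ric` and its size are controlled by (1.1)–(1.2);
Bartnik 1986, (4.3)–(4.4) for the analogous estimate of the scalar curvature.)
[cite: SchoenYauPMT1979, §3 p. 73] -/
theorem normSq_ricci_dataChart_le [D.metric.HasLeviCivita] {z : E3} (hz : e.R < ‖z‖)
    (hε : ‖hCoeff e D z - (innerSL ℝ : E3 →L[ℝ] E3 →L[ℝ] ℝ)‖ ≤ 1 / 6) :
    D.metric.normSq (e.dataChart ⟨z, hz⟩) (D.metric.ricci (e.dataChart ⟨z, hz⟩)) ≤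
      (3 : ℝ) ^ 4 * (4 * ((3 : ℝ) ^ 2 * (2 * (3 * ‖fderiv ℝ (fderiv ℝ (hCoeff e D)) z‖
        + (3 : ℝ) ^ 2 * (3 * ‖fderiv ℝ (hCoeff e D) z‖) ^ 2))) ^ 2) := by
  set g' := D.metric.comap PseudoRiemannianMetric.contMDiff_pullbackBilin_holds e.dataChart
    e.contMDiff_dataChart_succ e.injective_mfderiv_dataChart rfl with hg'
  haveI := g'.hasLeviCivita
  set b := EuclideanSpace.basisFun (Fin 3) ℝ with hb
  have hG2 : ContDiffAt ℝ 2 (hCoeff e D) z :=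
    (e.contDiffAt_hCoeff D hz).of_le (WithTop.coe_le_coe.mpr le_top)
  have h3 : (Fintype.card (Fin 3) : ℝ) = 3 := by simp
  -- the inverse Gram matrix has entries at most `2`
  have hε0 : 0 ≤ ‖hCoeff e D z - (innerSL ℝ : E3 →L[ℝ] E3 →L[ℝ] ℝ)‖ := norm_nonneg _
  have hsmall : Fintype.card (Fin 3) * ‖hCoeff e D z - (innerSL ℝ : E3 →L[ℝ] E3 →L[ℝ] ℝ)‖ ≤
      1 / 2 := by
    rw [Fintype.card_fin]
    push_cast
    linarith
  have hGi : ∀ i j, |(Matrix.of fun i j ↦ hCoeff e D z (b i) (b j))⁻¹ i j| ≤ 2 := fun i j ↦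
    (Matrix.abs_inv_sub_one_le (Matrix.of fun i j ↦ hCoeff e D z (b i) (b j)) hε0 hsmall
      (fun i j ↦ abs_gram_sub_one_le b z i j) i j).2
  -- bounds for the Koszul forms and their derivatives
  have hK : ∀ a c d : Fin 3, |OpensChart.koszulForm (hCoeff e D) z (b a) (b c) (b d)| ≤
      3 * ‖fderiv ℝ (hCoeff e D) z‖ := by
    intro a c d
    rw [OpensChart.koszulForm_apply]
    have h1 := abs_fderiv_apply_le (G := hCoeff e D) b z c a d
    have h2 := abs_fderiv_apply_le (G := hCoeff e D) b z a d c
    have h3 := abs_fderiv_apply_le (G := hCoeff e D) b z d c a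
    have := abs_add_le (fderiv ℝ (hCoeff e D) z (b c) (b a) (b d))
      (fderiv ℝ (hCoeff e D) z (b a) (b d) (b c))
    have := abs_sub (fderiv ℝ (hCoeff e D) z (b c) (b a) (b d) +
      fderiv ℝ (hCoeff e D) z (b a) (b d) (b c)) (fderiv ℝ (hCoeff e D) z (b d) (b c) (b a))
    linarith
  have hP : ∀ a c d e' : Fin 3,
      |fderiv ℝ (fun y ↦ OpensChart.koszulForm (hCoeff e D) y (b c) (b d) (b e')) z (b a)| ≤
        3 * ‖fderiv ℝ (fderiv ℝ (hCoeff e D)) z‖ := by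
    intro a c d e'
    rw [fderiv_koszulForm_eq hG2]
    have h1 := abs_fderiv_fderiv_apply_le (G := hCoeff e D) b z a d c e'
    have h2 := abs_fderiv_fderiv_apply_le (G := hCoeff e D) b z a c e' d
    have h3 := abs_fderiv_fderiv_apply_le (G := hCoeff e D) b z a e' d c
    have := abs_add_le (fderiv ℝ (fderiv ℝ (hCoeff e D)) z (b a) (b d) (b c) (b e'))
      (fderiv ℝ (fderiv ℝ (hCoeff e D)) z (b a) (b c) (b e') (b d))
    have := abs_sub (fderiv ℝ (fderiv ℝ (hCoeff e D)) z (b a) (b d) (b c) (b e') +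
      fderiv ℝ (fderiv ℝ (hCoeff e D)) z (b a) (b c) (b e') (b d))
      (fderiv ℝ (fderiv ℝ (hCoeff e D)) z (b a) (b e') (b d) (b c))
    linarith
  -- the point and the standard frame, at tangent-space types
  set x₀ : exteriorRegion e.R := ⟨z, hz⟩ with hx₀
  set β : Module.Basis (Fin 3) ℝ (TangentSpace 𝓘(ℝ, E3) x₀) := b.toBasis with hβ
  -- the Gram matrix of the pulled-back metric in the standard frame is `(h_ij(z))`
  have hentry : ∀ i j, g'.val x₀ (β i) (β j) = hCoeff e D z (b i) (b j) := fun i j ↦ by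
    rw [e.val_comap_dataChart D x₀]
    rfl
  have hGi' : ∀ i j, |(Matrix.of fun i j ↦ g'.val x₀ (β i) (β j))⁻¹ i j| ≤ 2 := fun i j ↦
    (Matrix.abs_inv_sub_one_le (Matrix.of fun i j ↦ g'.val x₀ (β i) (β j)) hε0 hsmall
      (fun i j ↦ by
        have h := abs_gram_sub_one_le (G := hCoeff e D) b z i j
        rw [Matrix.of_apply] at h ⊢
        rwa [hentry]) i j).2
  -- the Ricci components of the pulled-back metric in the standard frame
  set ρ : ℝ := (3 : ℝ) ^ 2 * (2 * (3 * ‖fderiv ℝ (fderiv ℝ (hCoeff e D)) z‖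
    + (3 : ℝ) ^ 2 * (3 * ‖fderiv ℝ (hCoeff e D) z‖) ^ 2)) with hρ
  have hRc : ∀ k l, |g'.ricci x₀ (β k) (β l)| ≤ ρ := by
    intro k l
    rw [OpensChart.ricci_eq_coord (e.val_comap_dataChart D) x₀ β k l]
    have := abs_ricciSum_le ((Matrix.of fun i j ↦ hCoeff e D z (β i) (β j))⁻¹)
      (fun a c d e' ↦ fderiv ℝ (fun y ↦
        OpensChart.koszulForm (hCoeff e D) y (β c) (β d) (β e')) z (β a))
      (fun a c d ↦ OpensChart.koszulForm (hCoeff e D) z (β a) (β c) (β d))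
      (fun i j ↦ hGi i j) (fun a c d e' ↦ hP a c d e') (fun a c d ↦ hK a c d) k l
    rw [h3] at this
    exact this
  -- naturality and the frame expression of `‖Ric‖²`
  have hnat := D.metric.normSq_ricci_comap PseudoRiemannianMetric.contMDiff_pullbackBilin_holds
    e.contMDiff_dataChart_succ e.injective_mfderiv_dataChart rfl x₀
  have key := abs_normSqSum_le ((Matrix.of fun i j ↦ g'.val x₀ (β i) (β j))⁻¹)
    (fun c i ↦ g'.ricci x₀ (β c) (β i)) hGi' hRc
  rw [h3] at key
  rw [← hnat, g'.normSq_eq_sum_gram_inv x₀ β]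
  exact (le_abs_self _).trans key

/-! ### Decay of `‖Ric‖²` along the end -/

/-- **`‖Ric‖² = O(r^{-2α-4})` on an asymptotically flat end.** If `h − δ = O₂(r^{−α})` with
`α > 0` (`IsMetricAsymptoticallyFlat`), there are `K` and `R₁ > R`, `R₁ ≥ 1`, with
`‖Ric‖²_h(Φ z) ≤ K ‖z‖^{−(2α+4)}` for `‖z‖ ≥ R₁` (the decay `|∂h| ≤ c₁ r^{−α−1}`,
`|∂²h| ≤ c₂ r^{−α−2}`, `‖h − δ‖ ≤ c₀ r^{−α} ≤ 1/6` inserted in `normSq_ricci_dataChart_le`).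
Schoen–Yau 1979, p. 73 (for (1.1)–(1.2): `Ric = O(r⁻³)`, and `O(r⁻⁴)` when `M = 0`).
[cite: SchoenYauPMT1979, §3 p. 73] -/
theorem exists_bound_normSq_ricci [D.metric.HasLeviCivita] {α : ℝ} (hα : 0 < α)
    (hAF : IsMetricAsymptoticallyFlat e D α) :
    ∃ K R₁ : ℝ, e.R < R₁ ∧ 1 ≤ R₁ ∧ ∀ z : E3, R₁ ≤ ‖z‖ →
      D.metric.normSq (e.dataChartExt z) (D.metric.ricci (e.dataChartExt z)) ≤
        K * ‖z‖ ^ (-(2 * α + 4)) := by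
  obtain ⟨c₀, hc₀, h0⟩ := (hAF 0 (by norm_num)).exists_pos
  obtain ⟨c₁, hc₁, h1⟩ := (hAF 1 (by norm_num)).exists_pos
  obtain ⟨c₂, hc₂, h2⟩ := (hAF 2 (by norm_num)).exists_pos
  have hfd : ∀ y, fderiv ℝ (fun y ↦ hCoeff e D y - (innerSL ℝ : E3 →L[ℝ] E3 →L[ℝ] ℝ)) y =
      fderiv ℝ (hCoeff e D) y := fun y ↦ fderiv_sub_const _
  have hfdd : fderiv ℝ (fderiv ℝ (fun y ↦ hCoeff e D y - (innerSL ℝ : E3 →L[ℝ] E3 →L[ℝ] ℝ))) =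
      fderiv ℝ (fderiv ℝ (hCoeff e D)) := by
    have : fderiv ℝ (fun y ↦ hCoeff e D y - (innerSL ℝ : E3 →L[ℝ] E3 →L[ℝ] ℝ)) =
        fderiv ℝ (hCoeff e D) := funext hfd
    rw [this]
  have hsmall : ∀ᶠ x in cobounded E3, c₀ * ‖x‖ ^ (-α) < 1 / 6 := by
    have ht : Tendsto (fun x : E3 ↦ c₀ * ‖x‖ ^ (-α)) (cobounded E3) (𝓝 0) := by
      rw [← mul_zero c₀]
      exact ((tendsto_rpow_neg_atTop hα).comp tendsto_norm_cobounded_atTop).const_mul c₀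
    exact ht.eventually (Iio_mem_nhds (by norm_num))
  set L : ℝ := (3 : ℝ) ^ 2 * (2 * (3 * c₂ + (3 : ℝ) ^ 2 * (3 * c₁) ^ 2)) with hL
  set K : ℝ := (3 : ℝ) ^ 4 * (4 * L ^ 2) with hK
  have hev : ∀ᶠ x in cobounded E3,
      D.metric.normSq (e.dataChartExt x) (D.metric.ricci (e.dataChartExt x)) ≤
        K * ‖x‖ ^ (-(2 * α + 4)) := by
    filter_upwards [h0.bound, h1.bound, h2.bound, hsmall, eventually_cobounded_le_norm (E := E3)
      (e.R + 1), eventually_cobounded_le_norm (E := E3) 1] with x hx0 hx1 hx2 hxs hxR hx1'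
    have hxpos : 0 < ‖x‖ := by linarith
    have hRx : e.R < ‖x‖ := by linarith
    rw [norm_norm, norm_iteratedFDeriv_zero, Real.norm_of_nonneg (Real.rpow_nonneg hxpos.le _)]
      at hx0
    rw [norm_norm, norm_iteratedFDeriv_one, hfd,
      Real.norm_of_nonneg (Real.rpow_nonneg hxpos.le _)] at hx1
    rw [norm_norm, ← norm_iteratedFDeriv_fderiv, norm_iteratedFDeriv_one, hfdd,
      Real.norm_of_nonneg (Real.rpow_nonneg hxpos.le _)] at hx2
    have hε0 : ‖hCoeff e D x - (innerSL ℝ : E3 →L[ℝ] E3 →L[ℝ] ℝ)‖ ≤ c₀ * ‖x‖ ^ (-α) := by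
      simpa using hx0
    have hε : ‖hCoeff e D x - (innerSL ℝ : E3 →L[ℝ] E3 →L[ℝ] ℝ)‖ ≤ 1 / 6 := hε0.trans hxs.le
    have hmain := e.normSq_ricci_dataChart_le D hRx hε
    rw [← e.dataChartExt_of_lt hRx] at hmain
    set p := ‖fderiv ℝ (fderiv ℝ (hCoeff e D)) x‖ with hpdef
    set q := ‖fderiv ℝ (hCoeff e D) x‖ with hqdef
    set t := ‖x‖ ^ (-α - 2) with htdef
    set u := ‖x‖ ^ (-α - 1) with hudef
    have hq1 : q ≤ c₁ * u := by simpa using hx1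
    have hp2 : p ≤ c₂ * t := by
      have : ((2 : ℕ) : ℝ) = 2 := by norm_num
      rw [this] at hx2
      exact hx2
    have hpnn : 0 ≤ p := norm_nonneg (fderiv ℝ (fderiv ℝ (hCoeff e D)) x)
    have hqnn : 0 ≤ q := norm_nonneg (fderiv ℝ (hCoeff e D) x)
    have htnn : 0 ≤ t := Real.rpow_nonneg hxpos.le _
    have hunn : 0 ≤ u := Real.rpow_nonneg hxpos.le _
    have hu2 : u ^ 2 ≤ t := by
      rw [hudef, htdef, ← Real.rpow_natCast, ← Real.rpow_mul hxpos.le]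
      refine Real.rpow_le_rpow_of_exponent_le hx1' ?_
      push_cast
      linarith
    have ht2 : t ^ 2 = ‖x‖ ^ (-(2 * α + 4)) := by
      rw [htdef, ← Real.rpow_natCast, ← Real.rpow_mul hxpos.le]
      congr 1
      push_cast
      ring
    -- `ρ ≤ L t`
    set ρ : ℝ := (3 : ℝ) ^ 2 * (2 * (3 * p + (3 : ℝ) ^ 2 * (3 * q) ^ 2)) with hρ
    have hρ0 : 0 ≤ ρ := by positivity
    have hq2 : q ^ 2 ≤ c₁ ^ 2 * t := by
      calc q ^ 2 ≤ (c₁ * u) ^ 2 := pow_le_pow_left₀ hqnn hq1 2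
        _ = c₁ ^ 2 * u ^ 2 := by ring
        _ ≤ c₁ ^ 2 * t := by gcongr
    have hρle : ρ ≤ L * t := by
      have e1 : ρ = 54 * p + 1458 * q ^ 2 := by rw [hρ]; ring
      have e2 : L * t = 54 * (c₂ * t) + 1458 * (c₁ ^ 2 * t) := by rw [hL]; ring
      rw [e1, e2]
      linarith
    calc D.metric.normSq (e.dataChartExt x) (D.metric.ricci (e.dataChartExt x))
        ≤ (3 : ℝ) ^ 4 * (4 * ρ ^ 2) := hmain
      _ ≤ (3 : ℝ) ^ 4 * (4 * (L * t) ^ 2) := by gcongr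
      _ = K * ‖x‖ ^ (-(2 * α + 4)) := by rw [hK, mul_pow, ht2]; ring
  obtain ⟨R₁, hR₁⟩ := exists_radius_of_eventually hev
  refine ⟨K, max R₁ (max (e.R + 1) 1), ?_, (le_max_right _ _).trans (le_max_right _ _),
    fun x hx ↦ hR₁ x ((le_max_left _ _).trans hx)⟩
  have h1 := le_max_left (e.R + 1) 1
  have h2 := le_max_right R₁ (max (e.R + 1) 1)
  linarith

/-- **The volume density of the end is bounded**: under `h − δ = O₂(r^{−α})`, `α > 0`, there is
`R₃` with `√(det h_{ij}(z)) ≤ 7` for `‖z‖ ≥ R₃` (`‖h(z) − δ‖ ≤ 1` eventually, so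
`|h_{ij}| ≤ 2` and `det ≤ 3! · 2³ = 48 < 49`). [folklore] -/
theorem exists_radius_sqrt_det_hCoeff_le {α : ℝ} (hα : 0 < α)
    (hAF : IsMetricAsymptoticallyFlat e D α) :
    ∃ R₃ : ℝ, ∀ z : E3, R₃ ≤ ‖z‖ → Real.sqrt (Matrix.of fun i j ↦
      hCoeff e D z (EuclideanSpace.single i 1) (EuclideanSpace.single j 1)).det ≤ 7 := by
  obtain ⟨c₀, hc₀, h0⟩ := (hAF 0 (by norm_num)).exists_pos
  have hsmall : ∀ᶠ x in cobounded E3, c₀ * ‖x‖ ^ (-α) < 1 := by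
    have ht : Tendsto (fun x : E3 ↦ c₀ * ‖x‖ ^ (-α)) (cobounded E3) (𝓝 0) := by
      rw [← mul_zero c₀]
      exact ((tendsto_rpow_neg_atTop hα).comp tendsto_norm_cobounded_atTop).const_mul c₀
    exact ht.eventually (Iio_mem_nhds (by norm_num))
  have hev : ∀ᶠ x in cobounded E3, Real.sqrt (Matrix.of fun i j ↦
      hCoeff e D x (EuclideanSpace.single i 1) (EuclideanSpace.single j 1)).det ≤ 7 := by
    filter_upwards [h0.bound, hsmall, eventually_cobounded_le_norm (E := E3) 1] with x hx0 hxs hx1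
    have hxpos : 0 < ‖x‖ := by linarith
    rw [norm_norm, norm_iteratedFDeriv_zero, Real.norm_of_nonneg (Real.rpow_nonneg hxpos.le _)]
      at hx0
    have hε : ‖hCoeff e D x - (innerSL ℝ : E3 →L[ℝ] E3 →L[ℝ] ℝ)‖ ≤ 1 := by
      have : ‖hCoeff e D x - (innerSL ℝ : E3 →L[ℝ] E3 →L[ℝ] ℝ)‖ ≤ c₀ * ‖x‖ ^ (-α) := by
        simpa using hx0
      exact this.trans hxs.le
    have hnorm : ‖hCoeff e D x‖ ≤ 2 := by
      have h1 := norm_le_norm_sub_add (hCoeff e D x) (innerSL ℝ : E3 →L[ℝ] E3 →L[ℝ] ℝ)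
      have h2 : ‖(innerSL ℝ : E3 →L[ℝ] E3 →L[ℝ] ℝ)‖ ≤ 1 := norm_innerSL_le ℝ
      linarith
    have hentries : ∀ i j, |(Matrix.of fun i j ↦ hCoeff e D x (EuclideanSpace.single i 1)
        (EuclideanSpace.single j 1)) i j| ≤ 2 := by
      intro i j
      rw [Matrix.of_apply]
      have h := (hCoeff e D x).le_opNorm₂ (EuclideanSpace.single i (1 : ℝ))
        (EuclideanSpace.single j (1 : ℝ))
      have hs : ∀ k : Fin 3, ‖(EuclideanSpace.single k (1 : ℝ) : E3)‖ = 1 := fun k ↦ by simp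
      rw [hs, hs, mul_one, mul_one, Real.norm_eq_abs] at h
      exact h.trans hnorm
    have hdet : |(Matrix.of fun i j ↦ hCoeff e D x (EuclideanSpace.single i 1)
        (EuclideanSpace.single j 1)).det| ≤ 48 := by
      have h := Matrix.det_le (abv := AbsoluteValue.abs) (fun i j ↦
        (show AbsoluteValue.abs ((Matrix.of fun i j ↦ hCoeff e D x (EuclideanSpace.single i 1)
          (EuclideanSpace.single j 1)) i j) ≤ 2 from hentries i j))
      rw [AbsoluteValue.abs_apply, Fintype.card_fin] at h
      norm_num at h
      exact h
    calc Real.sqrt (Matrix.of fun i j ↦ hCoeff e D x (EuclideanSpace.single i 1)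
          (EuclideanSpace.single j 1)).det
        ≤ Real.sqrt 49 := Real.sqrt_le_sqrt (by linarith [le_abs_self (Matrix.of fun i j ↦
            hCoeff e D x (EuclideanSpace.single i 1) (EuclideanSpace.single j 1)).det])
      _ = 7 := by
          rw [show (49 : ℝ) = 7 ^ 2 by norm_num, Real.sqrt_sq (by norm_num)]
  obtain ⟨R₃, hR₃⟩ := exists_radius_of_eventually hev
  exact ⟨R₃, hR₃⟩

/-- Strong asymptotic flatness with vanishing mass parameter, `h − δ = o_{nh}(r^{−β})` with
`nh ≥ 2`, implies Bartnik's `h − δ = O₂(r^{−β})`. [folklore] -/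
theorem IsStronglyAsymptoticallyFlatWith.isMetricAsymptoticallyFlat_of_massZero {β γ : ℝ}
    {nh nk : ℕ} (h : IsStronglyAsymptoticallyFlatWith e D 0 β γ nh nk) (hnh : 2 ≤ nh) :
    IsMetricAsymptoticallyFlat e D β := by
  intro m hm
  have h1 := h.1 m (hm.trans hnh)
  have hfun : (fun y ↦ hCoeff e D y - (1 + 2 * (0 : ℝ) / ‖y‖) •
      (innerSL ℝ : E3 →L[ℝ] E3 →L[ℝ] ℝ)) =
      fun y ↦ hCoeff e D y - (innerSL ℝ : E3 →L[ℝ] E3 →L[ℝ] ℝ) := by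
    funext y
    simp
  rw [hfun] at h1
  exact h1.isBigO

end AFEnd

end Literature.Geometry.Lorentzian

end
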